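import Literature.Probability.Percolation.QuadCrossingQuadTopology
import Literature.Probability.Percolation.QuadCrossingSquareModel
import HarnessLib

/-!
# The boundary loop of a quad and the four-point crossing lemma

Topic `Probability/Percolation`; proofs file towards Schramm–Smirnov's continuity Lemma 6.1
(`SchrammSmirnov2011_lemma_6_1`, file `QuadCrossingContinuity.lean`; O. Schramm, S. Smirnov, *On the
scaling limits of planar percolation*, Ann. Probab. 39 (2011), arXiv:1101.5820, §6, condition (1):
"a path `γ ⊂ [Q]` of diameter at most `δ` that separates `{Q(1,1), Q'(1,1)}` from `∂₀Q ∪ ∂₁Q` inside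
`[Q]`").  Case (1) compares two quads with the same carrier whose corners `Q(1,1)`, `Q'(1,1)` both
lie behind a short cut `γ`; the topological input is the **four-point crossing lemma**: for four
boundary points `p₁, p₂, p₃, p₄` of `[Q]` in cyclic order, a continuum in `[Q]` through `p₁` and
`p₃` meets every path in `[Q]` from `p₂` to `p₄`.  We prove it by re-marking the Jordan domain
`int [Q]` at the four points and straightening with a square model (`exists_isSquareModel`,
`QuadCrossingSquareModel.lean`), which reduces it to the rectangle crossing lemma
`exists_mem_of_isPreconnected_crossing` (`RectangleDuality.lean`).

* `Quad.exists_boundaryLoop` — a `1`-periodic simple loop `L` tracing `∂[Q]`, namely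
  `L = H ∘ ∂(unit model square)` for the straightening homeomorphism `H`: `L([0, 1/4]) = ∂₁Q`,
  `L([1/4, 1/2]) = ∂₂Q`, `L([1/2, 3/4]) = ∂₃Q`, `L([3/4, 1]) = ∂₀Q`, together with the
  **four-point crossing property** for parameters `0 ≤ t₁ < t₂ < t₃ < t₄ < 1` (both pairings).

## References

* O. Schramm, S. Smirnov, Ann. Probab. 39 (2011) 1768–1814, arXiv:1101.5820, Lemma 6.1 (1) and its
  proof. [SchrammSmirnov2011]
-/

noncomputable section

open scoped unitInterval
open Set Filter Metric Function Complex
open _root_.Topology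
open Literature.Topology.PlaneTopology Literature.Probability.RandomPlanarGeometry

namespace Literature.Probability.Percolation

namespace QuadCrossing

variable {D : Set ℂ}

/-- The arcs of the unit model square as images of the quarter parameter intervals. [folklore] -/
theorem unitSquareQuad_arc_eq_image (k : Fin 4) :
    unitSquareQuad.arc k = unitSquareQuad.boundary '' Icc ((k : ℝ) / 4) (((k : ℝ) + 1) / 4) := by
  have hmark : ∀ i : Fin 4, unitSquareQuad.mark i = (i : ℝ) / 4 := fun i => rfl
  unfold MarkedDomain.arc
  congr 1
  · exact congrArg₂ Icc (hmark k) (by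
      by_cases h : k.val + 1 < 4
      · rw [MarkedDomain.nextMark_of_lt _ k h, hmark]
        simp
      · have hk : k = 3 := by
          apply Fin.ext
          have := k.isLt
          omega
        subst hk
        unfold MarkedDomain.nextMark
        rw [dif_neg (by decide), hmark]
        norm_num)

namespace Quad

/-- **The boundary loop of a quad and the four-point crossing lemma.**  There is a continuous
`1`-periodic loop `L`, injective on `[0,1)`, tracing `∂[Q]`, with `L([0,1/4]) = ∂₁Q`,
`L([1/4,1/2]) = ∂₂Q`, `L([1/2,3/4]) = ∂₃Q`, `L([3/4,1]) = ∂₀Q`, such that for all parameters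
`0 ≤ t₁ < t₂ < t₃ < t₄ < 1`: every compact connected `C ⊆ [Q]` containing `L t₁` and `L t₃` meets
every path in `[Q]` from `L t₂` to `L t₄`, and every compact connected `C ⊆ [Q]` containing `L t₂`
and `L t₄` meets every path in `[Q]` from `L t₁` to `L t₃`.  (Re-mark the Jordan domain `int[Q]` at
`t₁, …, t₄`, take a square model `Φ`; the pulled-back continuum contains two opposite corners of the
model square, the pulled-back path joins the other two; apply the rectangle crossing lemma.)
[cite: SchrammSmirnov2011, proof of Lemma 6.1, case (1)] -/
theorem exists_boundaryLoop (Q : Quad D) :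
    ∃ L : ℝ → ℂ, Continuous L ∧ Function.Periodic L 1 ∧ InjOn L (Ico 0 1) ∧
      range L = frontier Q.carrier ∧
      L '' Icc 0 (1 / 4) = Q.side 1 ∧ L '' Icc (1 / 4) (1 / 2) = Q.side 2 ∧
      L '' Icc (1 / 2) (3 / 4) = Q.side 3 ∧ L '' Icc (3 / 4) 1 = Q.side 0 ∧
      (∀ t₁ t₂ t₃ t₄ : ℝ, 0 ≤ t₁ → t₁ < t₂ → t₂ < t₃ → t₃ < t₄ → t₄ < 1 →
        (∀ C ⊆ Q.carrier, IsCompact C → IsPreconnected C → L t₁ ∈ C → L t₃ ∈ C →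
          ∀ K : ℝ → ℂ, ContinuousOn K (Icc 0 1) → MapsTo K (Icc 0 1) Q.carrier →
            K 0 = L t₂ → K 1 = L t₄ → ∃ s ∈ Icc (0 : ℝ) 1, K s ∈ C) ∧
        (∀ C ⊆ Q.carrier, IsCompact C → IsPreconnected C → L t₂ ∈ C → L t₄ ∈ C →
          ∀ K : ℝ → ℂ, ContinuousOn K (Icc 0 1) → MapsTo K (Icc 0 1) Q.carrier →
            K 0 = L t₁ → K 1 = L t₃ → ∃ s ∈ Icc (0 : ℝ) 1, K s ∈ C)) := by
  obtain ⟨H, -, hcar, h0, h1, h2, h3⟩ := Q.exists_straighten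
  -- the image Jordan domain and its loop
  set J : JordanDomain := unitSquareQuad.toJordanDomain.map H with hJ
  set L : ℝ → ℂ := H ∘ unitSquareQuad.boundary with hL
  have hHU : H '' unitSquareQuad.carrier = interior Q.carrier := by
    rw [unitSquareQuad_carrier, hcar, ← H.image_interior, interior_reProdIm, interior_Icc]
  have hJcar : J.carrier = interior Q.carrier := hHU
  have hJcl : closure J.carrier = Q.carrier := by rw [hJcar, Q.closure_interior_carrier]
  -- side images
  have hside : ∀ (k : Fin 4) (S : Set ℂ), (∀ p : ℂ, p ∈ unitSquareQuad.arc k ↔ p ∈ S) →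
      L '' Icc ((k : ℝ) / 4) (((k : ℝ) + 1) / 4) = H '' S := fun k S hS => by
    rw [hL, image_comp, ← unitSquareQuad_arc_eq_image]
    congr 1
    ext p
    exact hS p
  have hS1 : L '' Icc 0 (1 / 4) = Q.side 1 := by
    rw [h1]
    have := hside 0 {z | z ∈ Icc (-1 : ℝ) 1 ×ℂ Icc (-1 : ℝ) 1 ∧ z.im = -1} fun p => by
      rw [SquareModel.mem_arc_zero, mem_setOf_eq, mem_reProdIm, mem_Icc]
      constructor
      · rintro ⟨him, hre⟩; exact ⟨⟨hre, by rw [him]; norm_num⟩, him⟩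
      · rintro ⟨⟨hre, -⟩, him⟩; exact ⟨him, hre⟩
    norm_num at this
    exact this
  have hS2 : L '' Icc (1 / 4) (1 / 2) = Q.side 2 := by
    rw [h2]
    have := hside 1 {z | z ∈ Icc (-1 : ℝ) 1 ×ℂ Icc (-1 : ℝ) 1 ∧ z.re = 1} fun p => by
      rw [SquareModel.mem_arc_one, mem_setOf_eq, mem_reProdIm, mem_Icc]
      constructor
      · rintro ⟨hre, him⟩; exact ⟨⟨by rw [hre]; norm_num, him⟩, hre⟩
      · rintro ⟨⟨-, him⟩, hre⟩; exact ⟨hre, him⟩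
    norm_num at this
    exact this
  have hS3 : L '' Icc (1 / 2) (3 / 4) = Q.side 3 := by
    rw [h3]
    have := hside 2 {z | z ∈ Icc (-1 : ℝ) 1 ×ℂ Icc (-1 : ℝ) 1 ∧ z.im = 1} fun p => by
      rw [SquareModel.mem_arc_two, mem_setOf_eq, mem_reProdIm, mem_Icc]
      constructor
      · rintro ⟨him, hre⟩; exact ⟨⟨hre, by rw [him]; norm_num⟩, him⟩
      · rintro ⟨⟨hre, -⟩, him⟩; exact ⟨him, hre⟩
    norm_num at this
    exact this
  have hS0 : L '' Icc (3 / 4) 1 = Q.side 0 := by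
    rw [h0]
    have := hside 3 {z | z ∈ Icc (-1 : ℝ) 1 ×ℂ Icc (-1 : ℝ) 1 ∧ z.re = -1} fun p => by
      rw [SquareModel.mem_arc_three, mem_setOf_eq, mem_reProdIm, mem_Icc]
      constructor
      · rintro ⟨hre, him⟩; exact ⟨⟨by rw [hre]; norm_num, him⟩, hre⟩
      · rintro ⟨⟨-, him⟩, hre⟩; exact ⟨hre, him⟩
    norm_num at this
    exact this
  have hrange : range L = frontier Q.carrier := by
    rw [hL, range_comp, unitSquareQuad.range_boundary, H.image_frontier, hHU, frontier,
      interior_interior, Q.closure_interior_carrier, frontier, Q.isCompact_carrier.isClosed.closure_eq]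
  refine ⟨L, H.continuous.comp unitSquareQuad.continuous_boundary,
    unitSquareQuad.periodic_boundary.comp H, H.injective.comp_injOn unitSquareQuad.injOn_boundary,
    hrange, hS1, hS2, hS3, hS0, fun t₁ t₂ t₃ t₄ ht₁ h12 h23 h34 ht₄ => ?_⟩
  -- re-mark `J` at `t₁ < t₂ < t₃ < t₄` and straighten with a square model
  let R4 : ConformalRectangle :=
    { toJordanDomain := J
      mark := ![t₁, t₂, t₃, t₄]
      strictMono_mark := by
        refine Fin.strictMono_iff_lt_succ.2 fun i => ?_
        fin_cases i <;> simp [h12, h23, h34]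
      mark_mem := by
        intro i
        fin_cases i <;> simp <;> constructor <;> linarith }
  obtain ⟨Φ, hΦ⟩ := exists_isSquareModel R4
  have hpt : R4.pt 0 = L t₁ ∧ R4.pt 1 = L t₂ ∧ R4.pt 2 = L t₃ ∧ R4.pt 3 = L t₄ := by
    refine ⟨?_, ?_, ?_, ?_⟩ <;> simp [R4, MarkedDomain.pt, hJ, hL]
  have hcarΦ : Φ '' (Icc (-1 : ℝ) 1 ×ℂ Icc (-1 : ℝ) 1) = Q.carrier := by rw [hΦ.image_Icc]; exact hJcl
  have hpre : ∀ {z : ℂ}, z ∈ Q.carrier → Φ.symm z ∈ Icc (-1 : ℝ) 1 ×ℂ Icc (-1 : ℝ) 1 := by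
    intro z hz
    rw [← hcarΦ] at hz
    obtain ⟨w, hw, rfl⟩ := hz
    rwa [Homeomorph.symm_apply_apply]
  have harc : ∀ {k : Fin 4} {p : ℂ}, p ∈ R4.arc k → Φ.symm p ∈ unitSquareQuad.arc k := by
    intro k p hp
    rw [← hΦ.image_arc k] at hp
    obtain ⟨q, hq, rfl⟩ := hp
    rwa [Homeomorph.symm_apply_apply]
  -- marked points on the sides of the model square
  have e30 : (3 : Fin 4) + 1 = 0 := by decide
  have e01 : (0 : Fin 4) + 1 = 1 := by decide
  have e12 : (1 : Fin 4) + 1 = 2 := by decide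
  have e23 : (2 : Fin 4) + 1 = 3 := by decide
  have m0_3 : Φ.symm (L t₁) ∈ unitSquareQuad.arc 3 := by
    have := R4.pt_succ_mem_arc 3; rw [e30, hpt.1] at this; exact harc this
  have m0_0 : Φ.symm (L t₁) ∈ unitSquareQuad.arc 0 := by
    have := R4.pt_mem_arc_self 0; rw [hpt.1] at this; exact harc this
  have m1_0 : Φ.symm (L t₂) ∈ unitSquareQuad.arc 0 := by
    have := R4.pt_succ_mem_arc 0; rw [e01, hpt.2.1] at this; exact harc this
  have m1_1 : Φ.symm (L t₂) ∈ unitSquareQuad.arc 1 := by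
    have := R4.pt_mem_arc_self 1; rw [hpt.2.1] at this; exact harc this
  have m2_1 : Φ.symm (L t₃) ∈ unitSquareQuad.arc 1 := by
    have := R4.pt_succ_mem_arc 1; rw [e12, hpt.2.2.1] at this; exact harc this
  have m2_2 : Φ.symm (L t₃) ∈ unitSquareQuad.arc 2 := by
    have := R4.pt_mem_arc_self 2; rw [hpt.2.2.1] at this; exact harc this
  have m3_2 : Φ.symm (L t₄) ∈ unitSquareQuad.arc 2 := by
    have := R4.pt_succ_mem_arc 2; rw [e23, hpt.2.2.2] at this; exact harc this
  have m3_3 : Φ.symm (L t₄) ∈ unitSquareQuad.arc 3 := by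
    have := R4.pt_mem_arc_self 3; rw [hpt.2.2.2] at this; exact harc this
  -- the rectangle crossing lemma, pulled back by `Φ⁻¹`
  have key : ∀ (a c b d : ℂ), (Φ.symm a).re = -1 → (Φ.symm c).re = 1 → (Φ.symm b).im = -1 →
      (Φ.symm d).im = 1 →
      ∀ C ⊆ Q.carrier, IsCompact C → IsPreconnected C → a ∈ C → c ∈ C →
        ∀ K : ℝ → ℂ, ContinuousOn K (Icc 0 1) → MapsTo K (Icc 0 1) Q.carrier →
          K 0 = b → K 1 = d → ∃ s ∈ Icc (0 : ℝ) 1, K s ∈ C := by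
    intro a c b d ha hc hb hd C hCQ hCc hCconn haC hcC K hK hKQ hK0 hK1
    obtain ⟨s, hs, hmem⟩ := Literature.Topology.PlaneTopology.exists_mem_of_isPreconnected_crossing
      (K := Φ.symm '' C) (β := fun s => Φ.symm (K s)) (by norm_num : (-1 : ℝ) ≤ 1)
      (by norm_num : (-1 : ℝ) ≤ 1) (hCc.image Φ.symm.continuous)
      (hCconn.image _ Φ.symm.continuous.continuousOn)
      (fun _ ⟨w, hw, hzw⟩ => hzw ▸ hpre (hCQ hw)) ⟨Φ.symm a, mem_image_of_mem _ haC, ha⟩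
      ⟨Φ.symm c, mem_image_of_mem _ hcC, hc⟩ (Φ.symm.continuous.comp_continuousOn hK)
      (fun s hs => hpre (hKQ hs)) (by simp only [hK0]; exact hb) (by simp only [hK1]; exact hd)
    obtain ⟨w, hwC, hw⟩ := hmem
    exact ⟨s, hs, Φ.symm.injective hw ▸ hwC⟩
  constructor
  · intro C hCQ hCc hCconn h1C h3C K hK hKQ hK0 hK1
    exact key (L t₁) (L t₃) (L t₂) (L t₄) (SquareModel.mem_arc_three.1 m0_3).1
      (SquareModel.mem_arc_one.1 m2_1).1 (SquareModel.mem_arc_zero.1 m1_0).1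
      (SquareModel.mem_arc_two.1 m3_2).1 C hCQ hCc hCconn h1C h3C K hK hKQ hK0 hK1
  · intro C hCQ hCc hCconn h2C h4C K hK hKQ hK0 hK1
    exact key (L t₄) (L t₂) (L t₁) (L t₃) (SquareModel.mem_arc_three.1 m3_3).1
      (SquareModel.mem_arc_one.1 m1_1).1 (SquareModel.mem_arc_zero.1 m0_0).1
      (SquareModel.mem_arc_two.1 m2_2).1 C hCQ hCc hCconn h4C h2C K hK hKQ hK0 hK1

end Quad

end QuadCrossing

end Literature.Probability.Percolation
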